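import Literature.Analysis.FluidPDE.BackwardHeatLocalMaxProofs
import Literature.Analysis.FluidPDE.BackwardUniquenessRescale
import HarnessLib

/-!
# Interior gradient estimate and Liouville theorem for classical solutions of the heat equation

Topic `Literature/Analysis/PDE`.  For `C²` solutions `u : ℝ × E → F` of the heat equation
`∂ₜ u = Δ u` (time first, uncurried; frame operators `dt`, `lap`, `gradSq` of
`FluidPDE/CarlemanCalculus.lean`) on an open set of space-time over a finite-dimensional real
inner product space `E`:

* `exists_mul_sqrt_gradSq_le_of_heat` — **the scale-invariant interior gradient estimate**
  `λ |∇u(t₁, x₁)| ≤ C(E) sup_{[t₁ - λ², t₁] × B̄(x₁, λ)} ‖u‖` for every past cylinder inside the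
  domain (from the tree's local maximum estimate for the backward heat inequality,
  `Carleman.localMax_le_of_future_cylinder` with `c₁ = 0`, applied to the time-reversed parabolic
  rescaling `v(s, y) = u(t₁ - λ² s, x₁ + λ y)`, `Carleman.stAffine`);
* `heat_liouville` — **the Liouville theorem for ancient solutions of sublinear growth**: a `C²`
  solution on `(-∞, T) × E` with `‖u(t, x)‖ ≤ A (1 + ‖x‖ + √(T - t))^γ`, `0 ≤ γ < 1`, is constant
  (the gradient estimate on cylinders of size `λ → ∞` kills `∇u`; then `∂ₜ u = Δ u = 0`).

This is the Liouville ingredient of L. Simon's blow-up proof of the parabolic Schauder estimates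
(applied there to second derivatives of caloric limits), recorded for White's regularity theory of
mean curvature flow (`Geometry/Riemannian/WhiteLocalRegularityCylinderFlow*.lean`).
Everything is PROVED; no definitions, no named facts.

## References

* [Evans2010] L. C. Evans, *Partial Differential Equations*, 2nd ed., AMS 2010, §2.3.3
  (interior estimates on derivatives of solutions of the heat equation).
* L. Simon, *Schauder estimates by scaling*, Calc. Var. PDE 5 (1997) 391–407 (the blow-up
  method this Liouville theorem serves; not held — statement and proof here are self-contained).
* [Seregin2014] G. Seregin, *Lecture notes on regularity theory for the Navier–Stokes equations*,
  World Scientific 2014, App. A.2 (the local maximum estimate used, as vendored in the tree).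
-/

noncomputable section

open MeasureTheory Set Function Filter Metric Real
open scoped Topology

namespace Literature.Analysis.PDE

open Literature.Analysis.FluidPDE Literature.Analysis.FluidPDE.Carleman

variable {E : Type*} [NormedAddCommGroup E] [InnerProductSpace ℝ E] [FiniteDimensional ℝ E]
  [MeasurableSpace E] [BorelSpace E]
variable {F : Type*} [NormedAddCommGroup F] [InnerProductSpace ℝ F]

/-- `√(a + b) ≤ √a + √b`. [folklore] -/
private theorem sqrt_add_le' {a b : ℝ} (ha : 0 ≤ a) (hb : 0 ≤ b) :
    Real.sqrt (a + b) ≤ Real.sqrt a + Real.sqrt b := by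
  rw [Real.sqrt_le_left (by positivity)]
  nlinarith [Real.sq_sqrt ha, Real.sq_sqrt hb, Real.sqrt_nonneg a, Real.sqrt_nonneg b,
    mul_nonneg (Real.sqrt_nonneg a) (Real.sqrt_nonneg b)]

/-- **The interior gradient estimate for the heat equation** (scale-invariant form): there is
`C = C(E) > 0` such that for every `C²` solution `u` of `∂ₜ u = Δ u` on an open `U ⊆ ℝ × E` and
every past cylinder `[t₁ - λ², t₁] × B̄(x₁, λ) ⊆ U` on which `‖u‖ ≤ B`,
`λ |∇u(t₁, x₁)| ≤ C B`. [cite: Evans2010, §2.3.3 Thm. 9] -/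
theorem exists_mul_sqrt_gradSq_le_of_heat :
    ∃ C : ℝ, 0 < C ∧ ∀ {U : Set (ℝ × E)} {u : ℝ × E → F}, IsOpen U → ContDiffOn ℝ 2 u U →
      (∀ z ∈ U, dt u z = lap u z) →
      ∀ {t₁ : ℝ} {x₁ : E} {l B : ℝ}, 0 < l → Icc (t₁ - l ^ 2) t₁ ×ˢ closedBall x₁ l ⊆ U →
      (∀ z ∈ Icc (t₁ - l ^ 2) t₁ ×ˢ closedBall x₁ l, ‖u z‖ ≤ B) →
      l * Real.sqrt (gradSq u (t₁, x₁)) ≤ C * B := by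
  obtain ⟨C₀, hC₀, hLM⟩ := localMax_le_of_future_cylinder (E := E) (F := F) (c₁ := 0) le_rfl
  set K : Set (ℝ × E) := Icc (0 : ℝ) (0 + 1 ^ 2) ×ˢ closedBall (0 : E) 1 with hK
  have hKc : IsCompact K := isCompact_Icc.prod (isCompact_closedBall _ _)
  have hKfin : volume K < ⊤ := hKc.measure_lt_top
  set V : ℝ := volume.real K with hV
  refine ⟨C₀ * Real.sqrt V + 1, by positivity, ?_⟩
  intro U u hU hu hheat t₁ x₁ l B hl hcyl hB
  have hB0 : 0 ≤ B := (norm_nonneg _).trans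
    (hB (t₁, x₁) ⟨⟨by nlinarith, le_rfl⟩, mem_closedBall_self hl.le⟩)
  -- the time-reversed rescaling `v(s, y) = u(t₁ - l² s, x₁ + l y)`
  have hβ : (-(l ^ 2) : ℝ) ≠ 0 := by have := pow_pos hl 2; linarith
  have hγ : (l : ℝ) ≠ 0 := hl.ne'
  set Φ : ℝ × E → ℝ × E := stAffine (-(l ^ 2)) l t₁ x₁ with hΦ
  set v : ℝ × E → F := fun z => u (Φ z) with hv
  have hΦU : IsOpen (Φ ⁻¹' U) := hU.preimage (continuous_stAffine _ _ _ _)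
  have hvC : ContDiffOn ℝ 2 v (Φ ⁻¹' U) := contDiffOn_comp_stAffine hu _ _ _ _
  -- the cylinder `[0, 1] × B̄(0, 1)` is mapped into the given past cylinder
  have hΦK : ∀ z ∈ K, Φ z ∈ Icc (t₁ - l ^ 2) t₁ ×ˢ closedBall x₁ l := by
    rintro ⟨s, y⟩ ⟨⟨hs0, hs1⟩, hy⟩
    rw [mem_closedBall, dist_zero_right] at hy
    simp only [hΦ, stAffine_apply, mem_prod, mem_Icc, mem_closedBall, dist_eq_norm,
      add_sub_cancel_left, norm_smul, Real.norm_eq_abs, abs_of_pos hl]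
    refine ⟨⟨by nlinarith [pow_pos hl 2], by nlinarith [pow_pos hl 2]⟩, ?_⟩
    nlinarith
  have hKU : K ⊆ Φ ⁻¹' U := fun z hz => hcyl (hΦK z hz)
  -- `v` solves the backward heat equation on `Φ⁻¹ U`
  have hvBH : ∀ z ∈ Φ ⁻¹' U, ‖dt v z + lap v z‖ ≤ 0 * (‖v z‖ + Real.sqrt (gradSq v z)) := by
    intro z hz
    have h1 : dt v z = (-(l ^ 2)) • dt u (Φ z) := dt_comp_stAffine hβ hγ u z
    have h2 : lap v z = (l ^ 2) • lap u (Φ z) := lap_comp_stAffine hβ hγ u z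
    rw [h1, h2, hheat _ hz, neg_smul, neg_add_cancel, norm_zero, zero_mul]
  -- the local maximum estimate at the bottom centre `(0, 0)` of `[0, 1] × B̄(0, 1)`
  have key := hLM hΦU hvC hvBH (t := 0) (x := 0) (r := 1) one_pos le_rfl hKU
  rw [one_pow, div_one] at key
  -- identify the terms
  have hΦ0 : Φ (0, 0) = (t₁, x₁) := by simp [hΦ, stAffine_apply]
  have hv0 : v (0, 0) = u (t₁, x₁) := by simp only [hv, hΦ0]
  have hgrad : Real.sqrt (gradSq v (0, 0)) = l * Real.sqrt (gradSq u (t₁, x₁)) := by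
    have h : gradSq v (0, 0) = l ^ 2 * gradSq u (Φ (0, 0)) := gradSq_comp_stAffine hβ hγ u (0, 0)
    rw [h, hΦ0, Real.sqrt_mul (sq_nonneg _), Real.sqrt_sq hl.le]
  -- the `L²` norm over the unit cylinder is at most `B √V`
  have hint : Real.sqrt (∫ w in K, ‖v w‖ ^ 2) ≤ B * Real.sqrt V := by
    have h1 : ‖∫ w in K, ‖v w‖ ^ 2‖ ≤ B ^ 2 * V := by
      have h := norm_setIntegral_le_of_norm_le_const hKfin
        (f := fun w => ‖v w‖ ^ 2) (C := B ^ 2) fun w hw => ?_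
      · simpa [hV, mul_comm] using h
      · rw [Real.norm_eq_abs, abs_of_nonneg (sq_nonneg _)]
        exact pow_le_pow_left₀ (norm_nonneg _) (hB _ (hΦK w hw)) 2
    have h2 : ∫ w in K, ‖v w‖ ^ 2 ≤ B ^ 2 * V := (le_abs_self _).trans h1
    calc Real.sqrt (∫ w in K, ‖v w‖ ^ 2) ≤ Real.sqrt (B ^ 2 * V) := Real.sqrt_le_sqrt h2
      _ = B * Real.sqrt V := by rw [Real.sqrt_mul (sq_nonneg _), Real.sqrt_sq hB0]
  calc l * Real.sqrt (gradSq u (t₁, x₁)) = Real.sqrt (gradSq v (0, 0)) := hgrad.symm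
    _ ≤ ‖v (0, 0)‖ + Real.sqrt (gradSq v (0, 0)) := le_add_of_nonneg_left (norm_nonneg _)
    _ ≤ C₀ * Real.sqrt (∫ w in K, ‖v w‖ ^ 2) := key
    _ ≤ C₀ * (B * Real.sqrt V) := mul_le_mul_of_nonneg_left hint hC₀.le
    _ ≤ (C₀ * Real.sqrt V + 1) * B := by nlinarith [Real.sqrt_nonneg V]

omit [MeasurableSpace E] [BorelSpace E] in
/-- A continuous linear map on `ℝ × E` vanishing on `(1, 0)` and on `(0, e)` for the vectors `e`
of a basis is zero. [folklore] -/
private theorem clm_eq_zero_of_apply_eq_zero (A : ℝ × E →L[ℝ] F) (h1 : A (1, 0) = 0)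
    (h2 : ∀ i, A (0, stdOrthonormalBasis ℝ E i) = 0) : A = 0 := by
  -- the spatial part vanishes on a basis, hence everywhere
  have hsp : ∀ e : E, A (0, e) = 0 := by
    have hlin : (A.toLinearMap.comp (LinearMap.inr ℝ ℝ E)) = 0 :=
      (stdOrthonormalBasis ℝ E).toBasis.ext fun i => by simpa using h2 i
    intro e
    have := LinearMap.congr_fun hlin e
    simpa using this
  refine ContinuousLinearMap.ext fun p => ?_
  obtain ⟨r, e⟩ := p
  have hre : ((r, e) : ℝ × E) = r • ((1 : ℝ), (0 : E)) + ((0 : ℝ), e) := by simp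
  rw [hre, map_add, map_smul, h1, hsp, smul_zero, zero_add]
  simp

/-- **The Liouville theorem for ancient solutions of the heat equation with sublinear growth**:
a `C²` solution `u` of `∂ₜ u = Δ u` on `(-∞, T) × E` with
`‖u(t, x)‖ ≤ A (1 + ‖x‖ + √(T - t))^γ` for some `0 ≤ γ < 1` is constant.  (By the interior
gradient estimate on the past cylinders `[t₁ - λ², t₁] × B̄(x₁, λ)`,
`|∇u(t₁, x₁)| ≤ C A (b₀ + 2λ)^γ/λ → 0` as `λ → ∞`; so `∇u ≡ 0`, whence `Δ u ≡ 0 = ∂ₜ u` and `u` is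
constant on the convex domain.)  This is the Liouville ingredient of the blow-up proof of the
parabolic Schauder estimates (L. Simon, *Schauder estimates by scaling*, 1997). [folklore] -/
theorem heat_liouville {u : ℝ × E → F} {T A γ : ℝ} (hγ0 : 0 ≤ γ) (hγ1 : γ < 1)
    (hu : ContDiffOn ℝ 2 u (Iio T ×ˢ univ)) (hheat : ∀ z ∈ Iio T ×ˢ univ, dt u z = lap u z)
    (hgrowth : ∀ z ∈ Iio T ×ˢ univ, ‖u z‖ ≤ A * (1 + ‖z.2‖ + Real.sqrt (T - z.1)) ^ γ)
    {z w : ℝ × E} (hz : z ∈ Iio T ×ˢ univ) (hw : w ∈ Iio T ×ˢ univ) : u z = u w := by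
  have hUo : IsOpen (Iio T ×ˢ (univ : Set E)) := isOpen_Iio.prod isOpen_univ
  obtain ⟨C, hC, hgradEst⟩ := exists_mul_sqrt_gradSq_le_of_heat (E := E) (F := F)
  -- `A ≥ 0`
  have hA : 0 ≤ A := by
    have h1 := hgrowth z hz
    have hb : 0 < (1 + ‖z.2‖ + Real.sqrt (T - z.1)) ^ γ := by positivity
    nlinarith [norm_nonneg (u z)]
  -- Step 1: the spatial gradient vanishes identically
  have hgrad : ∀ p ∈ Iio T ×ˢ (univ : Set E), gradSq u p = 0 := by
    rintro ⟨t₁, x₁⟩ ⟨ht₁, -⟩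
    have ht₁' : t₁ < T := ht₁
    set b₀ : ℝ := 1 + ‖x₁‖ + Real.sqrt (T - t₁) with hb₀
    have hb₀1 : 1 ≤ b₀ := by have := norm_nonneg x₁; have := Real.sqrt_nonneg (T - t₁); linarith
    -- the estimate on the cylinder of size `l ≥ b₀`
    have hest : ∀ l : ℝ, b₀ ≤ l →
        Real.sqrt (gradSq u (t₁, x₁)) ≤ C * A * (3 : ℝ) ^ γ * l ^ (γ - 1) := by
      intro l hl
      have hl0 : 0 < l := by linarith
      have hcyl : Icc (t₁ - l ^ 2) t₁ ×ˢ closedBall x₁ l ⊆ Iio T ×ˢ (univ : Set E) :=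
        fun p hp => ⟨lt_of_le_of_lt hp.1.2 ht₁', mem_univ _⟩
      have hB : ∀ p ∈ Icc (t₁ - l ^ 2) t₁ ×ˢ closedBall x₁ l, ‖u p‖ ≤ A * (3 * l) ^ γ := by
        rintro ⟨t, x⟩ ⟨⟨ht1, ht2⟩, hx⟩
        rw [mem_closedBall, dist_eq_norm] at hx
        refine (hgrowth (t, x)
          (hcyl ⟨⟨ht1, ht2⟩, mem_closedBall.2 (by rwa [dist_eq_norm])⟩)).trans ?_
        refine mul_le_mul_of_nonneg_left (Real.rpow_le_rpow (by positivity) ?_ hγ0) hA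
        have hx' : ‖x‖ ≤ ‖x₁‖ + l := by
          have := norm_le_norm_add_norm_sub' x x₁   -- ‖x‖ ≤ ‖x₁‖ + ‖x - x₁‖
          linarith
        have ht' : Real.sqrt (T - t) ≤ Real.sqrt (T - t₁) + l := by
          calc Real.sqrt (T - t) ≤ Real.sqrt ((T - t₁) + l ^ 2) :=
                Real.sqrt_le_sqrt (by linarith)
            _ ≤ Real.sqrt (T - t₁) + Real.sqrt (l ^ 2) := sqrt_add_le' (by linarith) (sq_nonneg _)
            _ = Real.sqrt (T - t₁) + l := by rw [Real.sqrt_sq hl0.le]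
        show 1 + ‖x‖ + Real.sqrt (T - t) ≤ 3 * l
        linarith
      have h := hgradEst hUo hu hheat hl0 hcyl hB
      -- `l √gradSq ≤ C A (3l)^γ`; divide by `l`
      rw [Real.mul_rpow (by norm_num) hl0.le] at h
      rw [Real.rpow_sub_one hl0.ne',
        show C * A * (3 : ℝ) ^ γ * (l ^ γ / l) = C * A * (3 : ℝ) ^ γ * l ^ γ / l by ring,
        le_div_iff₀ hl0]
      calc Real.sqrt (gradSq u (t₁, x₁)) * l = l * Real.sqrt (gradSq u (t₁, x₁)) := mul_comm _ _
        _ ≤ C * (A * ((3 : ℝ) ^ γ * l ^ γ)) := h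
        _ = C * A * (3 : ℝ) ^ γ * l ^ γ := by ring
    have hlim : Tendsto (fun l : ℝ => C * A * (3 : ℝ) ^ γ * l ^ (γ - 1)) atTop (𝓝 0) := by
      have h := (tendsto_rpow_neg_atTop (by linarith : 0 < 1 - γ)).const_mul (C * A * (3 : ℝ) ^ γ)
      rw [mul_zero] at h
      refine h.congr' (Eventually.of_forall fun l => ?_)
      simp only [neg_sub]
    have hle : Real.sqrt (gradSq u (t₁, x₁)) ≤ 0 :=
      ge_of_tendsto hlim ((eventually_ge_atTop b₀).mono fun l hl => hest l hl)
    have hg0 : 0 ≤ gradSq u (t₁, x₁) := Finset.sum_nonneg fun i _ => sq_nonneg _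
    exact le_antisymm (Real.sqrt_eq_zero'.1 (le_antisymm hle (Real.sqrt_nonneg _))) hg0
  -- Step 2: all first derivatives vanish
  have hdx : ∀ p ∈ Iio T ×ˢ (univ : Set E), ∀ i, dx (stdOrthonormalBasis ℝ E i) u p = 0 := by
    intro p hp i
    have h : ∑ j, ‖dx (stdOrthonormalBasis ℝ E j) u p‖ ^ 2 = 0 := hgrad p hp
    have h' := (Finset.sum_eq_zero_iff_of_nonneg fun j _ => sq_nonneg _).1 h i (Finset.mem_univ _)
    exact norm_eq_zero.1 ((pow_eq_zero_iff two_ne_zero).1 h')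
  have hlap : ∀ p ∈ Iio T ×ˢ (univ : Set E), lap u p = 0 := by
    intro p hp
    change ∑ i, dx (stdOrthonormalBasis ℝ E i) (dx (stdOrthonormalBasis ℝ E i) u) p = 0
    refine Finset.sum_eq_zero fun i _ => ?_
    have hev : dx (stdOrthonormalBasis ℝ E i) u =ᶠ[𝓝 p] fun _ => (0 : F) :=
      Filter.eventually_of_mem (hUo.mem_nhds hp) fun q hq => hdx q hq i
    rw [dx_apply, hev.fderiv_eq]
    simp
  have hfd : ∀ p ∈ Iio T ×ˢ (univ : Set E), fderiv ℝ u p = 0 := fun p hp =>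
    clm_eq_zero_of_apply_eq_zero _ (by rw [← dt_apply, hheat p hp, hlap p hp]) fun i => by
      rw [← dx_apply]; exact hdx p hp i
  -- Step 3: `u` is constant on the convex domain
  have hconv : Convex ℝ (Iio T ×ˢ (univ : Set E)) := (convex_Iio T).prod convex_univ
  exact hconv.is_const_of_fderivWithin_eq_zero (hu.differentiableOn (by norm_num))
    (fun p hp => by rw [fderivWithin_of_isOpen hUo hp]; exact hfd p hp) hz hw

end Literature.Analysis.PDE
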